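import Summits.QuantumFields.GaugeBoot.PeriodicLoopEquationSchema
import Summits.QuantumFields.GaugeBoot.LoopEquationPairForm
import HarnessLib

/-!
# The single-link loop equation on a periodic lattice in the generators' REAL PAIR normal form (gauge-boot, periodic loop equations, pair form)

HONEST FRAMING (cell `pub-gaugeboot`, page 1 of every file): the venture produces certified bounds
on lattice expectations at stated coupling, gauge group, dimension and torus size; NOT a mass gap,
NOT a continuum limit, NOT a string tension, NOT large `N`; NOT Yang–Mills-summit-bearing (barriers
`FixedCouplingUltralocality`, `PerturbativeInvisibility`). This file enters NO bound, NO certificate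
and NO index row.

The analogue of `LoopEquationPairForm.lean` over the periodic lattice `(A, e)` of
`TiltedLatticeGauge.lean` (Wilson measure `μ_β = gibbs ρ e β`): the complex-trace loop equation of
`PeriodicLoopEquation.lean` with its occurrence sets decided on `ℤ^d` (`PeriodicLoopEquationSchema.lean`),
divided by `N²` and with real parts taken, i.e. the row a generator writes for a marked word before
canonicalisation. With the WRITTEN-OUT real variables
`w(C) := (1/N)·Re E[tr ρ(hol_x C)]` and `d(A, B) := Re E[tr ρ(hol_x A)·tr ρ(hol_x B)] / N²`
(no definition is introduced; expectations are `∫ … ∂(gibbs r.ρ e β)`):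

  `Σ_{k ∈ fwdOccZ} (d(w[0,k), w[k,n)) − s·w(w)/N²) − Σ_{k ∈ bwdOccZ} (d(w[0,k], w(k,n)) − s·w(w)/N²)`
  `  + (β/(2N))·Σ_{ν ≠ μ} Σ_{ε = ±} (w(w·P̃) − w(w·P̃⁻¹) − s·(d(w, P̃) − d(w, P̃⁻¹))) = 0`

(`loopEquation_pairForm`, any lattice representation `r` satisfying the pair identities; `s = 1`:
`loopEquation_pairForm_specialUnitaryGroup`, `s = 0`: `loopEquation_pairForm_unitaryGroup`), for
every word closed at `x` and SMALL for `(A, e)` (`Word.SmallFor`; on the 45°-tilted box: displacement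
bound `B` with `B + 1 < M_u`, `B + 1 < M_v`, `B + 2 ≤ L`, `smallFor_tiltedUnit_of_dispBound`), every real
`β`. By `PeriodicWordSymmetry.lean` the variables do not depend on the base point `x`. Everything is
`[folklore]`: the finite-`N` single-link Schwinger–Dyson equations in normalised pair form of
Anderson–Kruczenski (Nucl. Phys. B 921 (2017) 702, §2.2) / Kazakov–Zheng (JHEP 03 (2025) 099 =
arXiv:2404.16925, §2.3 (2.26)–(2.31)) / Guo–Li–Yang–Zhu (arXiv:2502.14421, §4 (4.13), (4.16)–(4.18),
§4.3 (4.29)); rigorous: Cao–Park–Sheffield, Thm. 5.7 (`U(N)`, `s = 0`), 6.104 (`SU(N)`, `s = 1`), on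
any finite periodic lattice. (Kazakov–Zheng arXiv:2203.11360 §2 is the LARGE-`N` loop equation and is
not a source for the finite-`N` form; locators per tribunal t2 add5 F-R13/F-R14/F-R16/F-R17.)
-/

noncomputable section

open MeasureTheory
open scoped Matrix
open Literature.MathematicalPhysics.QuantumFieldTheory (LatticeRep)
open Literature.MathematicalPhysics.QuantumLattice (fundamentalRep unitaryFundamentalRep fundamentalLatticeRep
  unitaryFundamentalLatticeRep)

namespace Summit.QuantumFields.GaugeBoot

namespace TiltedRP

variable {A : Type} [AddCommGroup A] [DecidableEq A] [Fintype A] {d : ℕ}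

section LatticeRepGeneral

variable {G : Type} [Group G] [TopologicalSpace G] [IsTopologicalGroup G] [CompactSpace G]
  [MeasurableSpace G] [BorelSpace G] (r : LatticeRep G) (e : Fin d → A)

omit [DecidableEq A] in
/-- `U ↦ tr ρ(hol_x(v)(U))` is integrable for the Wilson measure of the periodic lattice. [folklore] -/
theorem integrable_trace_wordHolonomy_latticeRep (β : ℝ) (x : A) (v : Word d) :
    Integrable (fun U : Config A d G => (r.ρ (wordHolonomy e U x v)).trace) (gibbs r.ρ e β) :=
  integrable_of_continuous_gibbs r e β (continuous_trace_wordHolonomy e r x v)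

omit [DecidableEq A] in
/-- `U ↦ tr ρ(hol_x(u)) · tr ρ(hol_y(v))` is integrable for the Wilson measure of the periodic lattice.
[folklore] -/
theorem integrable_trace_mul_trace_latticeRep (β : ℝ) (x y : A) (u v : Word d) :
    Integrable (fun U : Config A d G =>
      (r.ρ (wordHolonomy e U x u)).trace * (r.ρ (wordHolonomy e U y v)).trace) (gibbs r.ρ e β) :=
  integrable_of_continuous_gibbs r e β
    ((continuous_trace_wordHolonomy e r x u).mul (continuous_trace_wordHolonomy e r y v))

omit [DecidableEq A] in
/-- **The marked letter: `d([], C) = w(C)`** — `Re E[tr ρ(hol []) · tr ρ(hol C)] / N² = (1/N) Re E[tr ρ(hol C)]`.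
[folklore] -/
theorem re_integral_trace_nil_mul_trace_latticeRep (β : ℝ) (x : A) (v : Word d) :
    (∫ U, (r.ρ (wordHolonomy e U x ([] : Word d))).trace * (r.ρ (wordHolonomy e U x v)).trace
        ∂(gibbs r.ρ e β)).re / (r.N : ℝ) ^ 2 =
      (r.N : ℝ)⁻¹ * (∫ U, (r.ρ (wordHolonomy e U x v)).trace ∂(gibbs r.ρ e β)).re := by
  simp only [wordHolonomy_nil, map_one, Matrix.trace_one, Fintype.card_fin]
  rw [integral_const_mul, ← Complex.ofReal_natCast, Complex.re_ofReal_mul]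
  by_cases hN : (r.N : ℝ) = 0
  · simp [hN]
  · field_simp

omit [DecidableEq A] in
/-- **The split term, integrated**: for a prefix `w[0,k)` returning to `x`,
`∫ (tr A_k · tr B_k − (s/N) tr W) dμ_β = E[tr A_k · tr B_k] − (s/N)·E[tr W]`. [folklore] -/
theorem integral_splitTerm_latticeRep (β : ℝ) (s : ℂ) (x : A) (w : Word d) {k : ℕ}
    (hk : Word.siteAt e x w k = x) :
    ∫ U, ((r.ρ (wordHolonomy e U x (w.take k))).trace *
          (r.ρ (wordHolonomy e U (Word.siteAt e x w k) (w.drop k))).trace -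
        s / r.N * (r.ρ (wordHolonomy e U x w)).trace) ∂(gibbs r.ρ e β) =
      (∫ U, (r.ρ (wordHolonomy e U x (w.take k))).trace * (r.ρ (wordHolonomy e U x (w.drop k))).trace
          ∂(gibbs r.ρ e β)) -
        s / r.N * ∫ U, (r.ρ (wordHolonomy e U x w)).trace ∂(gibbs r.ρ e β) := by
  rw [hk, integral_sub (integrable_trace_mul_trace_latticeRep r e β x x _ _)
      ((integrable_trace_wordHolonomy_latticeRep r e β x w).const_mul _), integral_const_mul]

omit [DecidableEq A] in
/-- **The plaquette term, integrated.** [folklore] -/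
theorem integral_plaqTerm_latticeRep (β : ℝ) (s : ℂ) (x : A) (μ : Fin d) (w : Word d) (ν : Fin d)
    (ε : Bool) :
    ∫ U, plaqTerm r.ρ e s x μ U w ν ε ∂(gibbs r.ρ e β) =
      (∫ U, (r.ρ (wordHolonomy e U x (w ++ plaqWord μ ν ε))).trace ∂(gibbs r.ρ e β)) -
        (∫ U, (r.ρ (wordHolonomy e U x (w ++ (plaqWord μ ν ε).reverse))).trace ∂(gibbs r.ρ e β)) -
        s / r.N * ((∫ U, (r.ρ (wordHolonomy e U x w)).trace *
              (r.ρ (wordHolonomy e U x (plaqWord μ ν ε))).trace ∂(gibbs r.ρ e β)) -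
          (∫ U, (r.ρ (wordHolonomy e U x w)).trace *
              (r.ρ (wordHolonomy e U x (plaqWord μ ν ε).reverse)).trace ∂(gibbs r.ρ e β))) := by
  have hA := integrable_trace_wordHolonomy_latticeRep r e β x (w ++ plaqWord μ ν ε)
  have hB := integrable_trace_wordHolonomy_latticeRep r e β x (w ++ (plaqWord μ ν ε).reverse)
  have hP := integrable_trace_mul_trace_latticeRep r e β x x w (plaqWord μ ν ε)
  have hQ := integrable_trace_mul_trace_latticeRep r e β x x w (plaqWord μ ν ε).reverse
  have hAB : Integrable (fun U : Config A d G =>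
      (r.ρ (wordHolonomy e U x (w ++ plaqWord μ ν ε))).trace -
        (r.ρ (wordHolonomy e U x (w ++ (plaqWord μ ν ε).reverse))).trace) (gibbs r.ρ e β) :=
    hA.sub hB
  have hPQ : Integrable (fun U : Config A d G =>
      s / r.N * ((r.ρ (wordHolonomy e U x w)).trace * (r.ρ (wordHolonomy e U x (plaqWord μ ν ε))).trace) -
        s / r.N * ((r.ρ (wordHolonomy e U x w)).trace *
          (r.ρ (wordHolonomy e U x (plaqWord μ ν ε).reverse)).trace)) (gibbs r.ρ e β) :=
    (hP.const_mul _).sub (hQ.const_mul _)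
  simp only [plaqTerm, mul_sub]
  rw [integral_sub hAB hPQ, integral_sub hA hB, integral_sub (hP.const_mul _) (hQ.const_mul _),
    integral_const_mul, integral_const_mul]

/-- **THE SINGLE-LINK LOOP EQUATION ON A PERIODIC LATTICE IN REAL PAIR NORMAL FORM (any lattice
representation).** For `r` satisfying the pair identities at `(x, μ)` for the contractions `unitDir s`,
a word `w` closed at `x` and small for `(A, e)`, with `w(C) = (1/N) Re E[tr ρ(hol_x C)]` and
`d(A, B) = Re E[tr ρ(hol_x A) · tr ρ(hol_x B)] / N²` written out:
`Σ_{k ∈ fwdOccZ} (d(w[0,k), w[k,n)) − s·w(w)/N²) − Σ_{k ∈ bwdOccZ} (d(w[0,k], w(k,n)) − s·w(w)/N²)`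
`+ (β/(2N))·Σ_{ν ≠ μ} Σ_ε (w(w·P̃) − w(w·P̃⁻¹) − s·(d(w, P̃) − d(w, P̃⁻¹))) = 0`. [folklore] -/
theorem loopEquation_pairForm (β : ℝ) (x : A) (μ : Fin d) (s : ℝ) (w : Word d)
    (hw : Word.endpoint e x w = x) (hsm : Word.SmallFor e w)
    (hP : ∀ i j : Fin r.N, SDPair r e β x μ x w (unitDir (s : ℂ) i j)) :
    (∑ k ∈ (Finset.range w.length).filter (w.fwdOccZ μ),
        ((∫ U, (r.ρ (wordHolonomy e U x (w.take k))).trace * (r.ρ (wordHolonomy e U x (w.drop k))).trace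
            ∂(gibbs r.ρ e β)).re / (r.N : ℝ) ^ 2 -
          s * ((r.N : ℝ)⁻¹ * (∫ U, (r.ρ (wordHolonomy e U x w)).trace ∂(gibbs r.ρ e β)).re /
            (r.N : ℝ) ^ 2))) -
      (∑ k ∈ (Finset.range w.length).filter (w.bwdOccZ μ),
        ((∫ U, (r.ρ (wordHolonomy e U x (w.take (k + 1)))).trace *
              (r.ρ (wordHolonomy e U x (w.drop (k + 1)))).trace ∂(gibbs r.ρ e β)).re / (r.N : ℝ) ^ 2 -
          s * ((r.N : ℝ)⁻¹ * (∫ U, (r.ρ (wordHolonomy e U x w)).trace ∂(gibbs r.ρ e β)).re /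
            (r.N : ℝ) ^ 2))) +
      β / (2 * r.N) * ∑ ν ∈ Finset.univ.erase μ, ∑ ε : Bool,
        ((r.N : ℝ)⁻¹ * (∫ U, (r.ρ (wordHolonomy e U x (w ++ plaqWord μ ν ε))).trace ∂(gibbs r.ρ e β)).re -
          (r.N : ℝ)⁻¹ * (∫ U, (r.ρ (wordHolonomy e U x (w ++ (plaqWord μ ν ε).reverse))).trace
            ∂(gibbs r.ρ e β)).re -
          s * ((∫ U, (r.ρ (wordHolonomy e U x w)).trace * (r.ρ (wordHolonomy e U x (plaqWord μ ν ε))).trace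
                ∂(gibbs r.ρ e β)).re / (r.N : ℝ) ^ 2 -
            (∫ U, (r.ρ (wordHolonomy e U x w)).trace *
                (r.ρ (wordHolonomy e U x (plaqWord μ ν ε).reverse)).trace ∂(gibbs r.ρ e β)).re /
              (r.N : ℝ) ^ 2)) = 0 := by
  have h := loopEquation_schema r e β x μ (s : ℂ) w hw hsm hP
  -- forward occurrences: the prefix `w[0,k)` is closed at `x`
  have hf : ∀ k ∈ (Finset.range w.length).filter (w.fwdOccZ μ), Word.siteAt e x w k = x := fun k hk =>
    (Word.siteAt_eq_iff_of_smallFor e hsm x k).2 (Finset.mem_filter.1 hk).2.2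
  -- backward occurrences: the prefix `w[0,k]` is closed at `x`
  have hb : ∀ k ∈ (Finset.range w.length).filter (w.bwdOccZ μ), Word.siteAt e x w (k + 1) = x := by
    intro k hk
    obtain ⟨hk1, hk2⟩ := (Finset.mem_filter.1 hk).2
    refine (Word.siteAt_eq_iff_of_smallFor e hsm x (k + 1)).2 ?_
    rw [GaugeBoot.Word.dispZ_succ_of_getElem? hk1, hk2]
    ext i
    by_cases hi : i = μ
    · subst hi; simp [Step.dispZ]
    · simp [Step.dispZ, hi]
  rw [Finset.sum_congr rfl fun k hk => integral_splitTerm_latticeRep r e β (s : ℂ) x w (hf k hk),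
    Finset.sum_congr rfl fun k hk => integral_splitTerm_latticeRep r e β (s : ℂ) x w (hb k hk)] at h
  simp only [integral_plaqTerm_latticeRep] at h
  have hre := congrArg Complex.re h
  simp only [Complex.re_sum, Complex.add_re, Complex.sub_re, Complex.zero_re, re_ofReal_div_two_mul,
    re_ofReal_div_natCast_mul] at hre
  have h2 := congrArg (fun t : ℝ => 1 / (r.N : ℝ) ^ 2 * t) hre
  simp only [mul_zero, mul_add, mul_sub, Finset.mul_sum] at h2
  convert h2 using 2
  · congr 1
    · exact Finset.sum_congr rfl fun k _ => by ring
    · exact Finset.sum_congr rfl fun k _ => by ring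
  · rw [Finset.mul_sum]
    refine Finset.sum_congr rfl fun ν _ => ?_
    rw [Finset.mul_sum]
    exact Finset.sum_congr rfl fun ε _ => by ring

end LatticeRepGeneral

/-! ## `SU(N)` and `U(N)` -/

section Concrete

/-- **THE `SU(N)` LOOP EQUATION ON A PERIODIC LATTICE IN REAL PAIR NORMAL FORM** (every `N`, every
real `β`; `w` closed at `x` and small for `(A, e)`; `ρ` the fundamental representation; `s = 1`).
[folklore] -/
theorem loopEquation_pairForm_specialUnitaryGroup (N : ℕ) (e : Fin d → A) (β : ℝ) (x : A) (μ : Fin d)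
    (w : Word d) (hw : Word.endpoint e x w = x) (hsm : Word.SmallFor e w) :
    (∑ k ∈ (Finset.range w.length).filter (w.fwdOccZ μ),
        ((∫ U, (fundamentalRep (Fin N) (wordHolonomy e U x (w.take k))).trace *
              (fundamentalRep (Fin N) (wordHolonomy e U x (w.drop k))).trace
            ∂(gibbs (fundamentalRep (Fin N)) e β)).re / (N : ℝ) ^ 2 -
          (N : ℝ)⁻¹ * (∫ U, (fundamentalRep (Fin N) (wordHolonomy e U x w)).trace
            ∂(gibbs (fundamentalRep (Fin N)) e β)).re / (N : ℝ) ^ 2)) -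
      (∑ k ∈ (Finset.range w.length).filter (w.bwdOccZ μ),
        ((∫ U, (fundamentalRep (Fin N) (wordHolonomy e U x (w.take (k + 1)))).trace *
              (fundamentalRep (Fin N) (wordHolonomy e U x (w.drop (k + 1)))).trace
            ∂(gibbs (fundamentalRep (Fin N)) e β)).re / (N : ℝ) ^ 2 -
          (N : ℝ)⁻¹ * (∫ U, (fundamentalRep (Fin N) (wordHolonomy e U x w)).trace
            ∂(gibbs (fundamentalRep (Fin N)) e β)).re / (N : ℝ) ^ 2)) +
      β / (2 * N) * ∑ ν ∈ Finset.univ.erase μ, ∑ ε : Bool,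
        ((N : ℝ)⁻¹ * (∫ U, (fundamentalRep (Fin N) (wordHolonomy e U x (w ++ plaqWord μ ν ε))).trace
            ∂(gibbs (fundamentalRep (Fin N)) e β)).re -
          (N : ℝ)⁻¹ * (∫ U, (fundamentalRep (Fin N) (wordHolonomy e U x (w ++ (plaqWord μ ν ε).reverse))).trace
            ∂(gibbs (fundamentalRep (Fin N)) e β)).re -
          ((∫ U, (fundamentalRep (Fin N) (wordHolonomy e U x w)).trace *
                (fundamentalRep (Fin N) (wordHolonomy e U x (plaqWord μ ν ε))).trace
              ∂(gibbs (fundamentalRep (Fin N)) e β)).re / (N : ℝ) ^ 2 -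
            (∫ U, (fundamentalRep (Fin N) (wordHolonomy e U x w)).trace *
                (fundamentalRep (Fin N) (wordHolonomy e U x (plaqWord μ ν ε).reverse)).trace
              ∂(gibbs (fundamentalRep (Fin N)) e β)).re / (N : ℝ) ^ 2)) = 0 := by
  have h := loopEquation_pairForm (fundamentalLatticeRep N) e β x μ 1 w hw hsm
    fun i j => sdPair_specialUnitaryGroup N e β x μ x w _ (by rw [Complex.ofReal_one]; exact trace_unitDir_one i j)
  simp only [one_mul] at h
  exact h

/-- **THE `U(N)` LOOP EQUATION ON A PERIODIC LATTICE IN REAL PAIR NORMAL FORM** (`s = 0`: no `1/N²`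
terms and no pair plaquette terms). [folklore] -/
theorem loopEquation_pairForm_unitaryGroup (N : ℕ) (e : Fin d → A) (β : ℝ) (x : A) (μ : Fin d) (w : Word d)
    (hw : Word.endpoint e x w = x) (hsm : Word.SmallFor e w) :
    (∑ k ∈ (Finset.range w.length).filter (w.fwdOccZ μ),
        (∫ U, (unitaryFundamentalRep (Fin N) ℂ (wordHolonomy e U x (w.take k))).trace *
              (unitaryFundamentalRep (Fin N) ℂ (wordHolonomy e U x (w.drop k))).trace
            ∂(gibbs (unitaryFundamentalRep (Fin N) ℂ) e β)).re / (N : ℝ) ^ 2) -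
      (∑ k ∈ (Finset.range w.length).filter (w.bwdOccZ μ),
        (∫ U, (unitaryFundamentalRep (Fin N) ℂ (wordHolonomy e U x (w.take (k + 1)))).trace *
              (unitaryFundamentalRep (Fin N) ℂ (wordHolonomy e U x (w.drop (k + 1)))).trace
            ∂(gibbs (unitaryFundamentalRep (Fin N) ℂ) e β)).re / (N : ℝ) ^ 2) +
      β / (2 * N) * ∑ ν ∈ Finset.univ.erase μ, ∑ ε : Bool,
        ((N : ℝ)⁻¹ * (∫ U, (unitaryFundamentalRep (Fin N) ℂ (wordHolonomy e U x (w ++ plaqWord μ ν ε))).trace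
            ∂(gibbs (unitaryFundamentalRep (Fin N) ℂ) e β)).re -
          (N : ℝ)⁻¹ * (∫ U, (unitaryFundamentalRep (Fin N) ℂ
              (wordHolonomy e U x (w ++ (plaqWord μ ν ε).reverse))).trace
            ∂(gibbs (unitaryFundamentalRep (Fin N) ℂ) e β)).re) = 0 := by
  have h := loopEquation_pairForm (unitaryFundamentalLatticeRep N) e β x μ 0 w hw hsm
    fun i j => by rw [Complex.ofReal_zero]; exact sdPair_unitaryGroup N e β x μ x w _
  simp only [zero_mul, sub_zero] at h
  exact h

end Concrete

end TiltedRP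

end Summit.QuantumFields.GaugeBoot

end
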